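import Literature.AnabelianGeometry.AbsoluteAnabelian.AbsTopIII.KummerFaithfulSectionReductionProofs
import Literature.AnabelianGeometry.AbsoluteAnabelian.AbsTopIII.KummerFaithfulDedekindSectionsProofs
import Literature.AnabelianGeometry.AbsoluteAnabelian.AbsTopIII.KummerFaithfulCurveDedekindProofs
import Literature.AlgebraicGeometry.Motives.AbelianSchemeSpecialFibreDedekind
import Literature.NumberTheory.EllipticCurves.NeronModelExistenceProofs
import Literature.NumberTheory.EllipticCurves.NeronModelAbelianSchemeProofs
import Mathlib.RingTheory.Localization.Away.Basic
import HarnessLib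

/-!
# [AbsTopIII] Rmk. 1.5.4 (i), «restricting to various closed points»: the INDUCTION STEP over a Dedekind domain of characteristic zero

Proof-only companion (no new definitions) to `AbsTopIII/KummerFaithful.lean` (S. Mochizuki, *Topics in
Absolute Anabelian Geometry III*, §1, Def. 1.5 (a) p. 32 and Rmk. 1.5.4 (i) p. 33, lit key
`paper:url-5493eb38cbb7`: "every sub-`p`-adic field `k` [...] is Kummer-faithful [...]. Indeed, to
verify this, one reduces immediately [...] to the case where `k` is a finitely generated extension of
an MLF [...]. Then by restricting to various closed points of this variety, one reduces to the case
where `k` itself is an MLF").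

**The closed-point argument as an induction STEP, kernel-checked** (route memo F0369-FG-ROUTE of the
cell abc-iut, junctions J-a′/J-b/J-b′/J-c/J-d; this file is the Dedekind-form step that the strong
induction on transcendence degree calls at every level):

* `divisibleElementsTrivial_points_of_dedekind_of_residueFields` — let `R` be a Dedekind domain which
  is a `ℚ`-algebra with infinitely many maximal ideals, `L = Frac R`, and suppose that for EVERY closed
  point (every surjection `q : R ↠ κ` onto a field with `ker q ≠ 0`) every abelian variety over `κ`
  satisfies condition (a) of Def. 1.5.  Then every abelian variety `A / L` satisfies (a):
  `⋂_{N ≥ 1} N · A(L) = {0}`.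

It is `divisibleElementsTrivial_points_of_dedekind_padic` (`KummerFaithfulFunctionFieldCurveProofs`,
abc-iut-f-083: the transcendence-degree-one case, where the residue fields are MLF's and proper group
schemes over MLF's have no divisible points) with the MLF base case replaced by the residue hypothesis,
which is possible because the special fibre of the spread-out abelian scheme at a closed point is again
an ABELIAN VARIETY (`ZariskiDVR.specialFibreAbelianVariety`, `AbelianSchemeSpecialFibreDedekind` —
Zariski's connectedness theorem over a Dedekind base, `ZariskiConnectednessDVR`; characteristic `0`
makes the perfectness hypotheses automatic).

Proof (p. 33 made explicit, as in the degree-one file): `A` spreads out to a proper smooth group scheme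
`𝒜` over a localisation `R[1/f]` (`exists_abelianScheme_away_holds`), which is the Néron model of `A`
(`isNeronModel_of_isProper_of_smooth`), so `A(L) = 𝒜(R[1/f])` multiplicatively and a divisible point is
a divisible section (`KummerFaithfulNeronSectionsProofs`); at each of the infinitely many maximal ideals
`𝔪 ∌ f` of `R` the reduction `𝒜(R[1/f]) → 𝒜_𝔪(R/𝔪)` is a group homomorphism
(`KummerFaithfulSectionReductionProofs`) into the points of the ABELIAN VARIETY `𝒜_𝔪 / (R ⧸ 𝔪)`, which
has no divisible elements by hypothesis, so the section agrees with the unit section on infinitely many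
closed points and is the unit section (`Spec.sections_ext_of_infinite_fieldPoints`).

Universe-polymorphic in `u` (all of `R`, `L`, `κ`, `F` in `Type u`), as the consumer
`Rmk_1_5_4_i_of_abelianVariety_clause_fg` (universe `u`) requires.

HONEST FRAMING: a STEP, not the theorem — FACT-LIST row F-0369 (`Rmk_1_5_4_i`) in full generality
still needs the transcendence-degree bookkeeping that feeds the residue hypothesis from an induction
hypothesis (route «TRDEG-INDUCTION»). Nothing here bears on [IUTchIII] Cor. 3.12; typed ≠ discharged.
-/

noncomputable section

open _root_.CategoryTheory _root_.CategoryTheory.Limits _root_.AlgebraicGeometry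
open scoped _root_.CategoryTheory.MonObj _root_.CategoryTheory.Obj MonoidalCategory Classical Polynomial

namespace Literature.AnabelianGeometry.AbsoluteAnabelian.AbsTopIII

universe u

open Polynomial Literature.AlgebraicGeometry.Motives Literature.NumberTheory.EllipticCurves

/-- A maximal ideal of a ring with infinitely many maximal ideals is non-zero (if `⊥` were maximal,
every maximal ideal would equal `⊥`). Routine. [cite: MochizukiAbsTopIII2015, Rmk 1.5.4 (i) p.33] -/
theorem ne_bot_of_isMaximal_of_infinite {R : Type*} [CommRing R]
    (hinf : {𝔪 : Ideal R | 𝔪.IsMaximal}.Infinite) {𝔪 : Ideal R} (h𝔪 : 𝔪.IsMaximal) : 𝔪 ≠ ⊥ := by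
  intro h
  apply hinf
  refine (Set.finite_singleton (⊥ : Ideal R)).subset fun 𝔫 h𝔫 => ?_
  have h𝔫' : (𝔫 : Ideal R).IsMaximal := h𝔫
  have : 𝔪 = 𝔫 := h𝔪.eq_of_le h𝔫'.ne_top (h ▸ bot_le)
  rw [Set.mem_singleton_iff, ← this, h]

/-- **Condition (a) of Def. 1.5 for abelian varieties over the fraction field of a Dedekind domain of
characteristic zero, from the same condition over its residue fields** (the induction step of the
printed "restricting to various closed points of this variety", [AbsTopIII] Rmk. 1.5.4 (i) p. 33): let
`R` be a Dedekind `ℚ`-algebra with infinitely many maximal ideals and `L = Frac R`; if for every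
surjection `q : R ↠ κ` onto a field with `ker q ≠ ⊥` every abelian variety over `κ` has no non-trivial
divisible rational point, then neither has any abelian variety over `L`.  Spread `A` out to a proper
smooth group scheme over `R[1/f]` (its Néron model), turn a divisible point into a divisible section,
reduce at the infinitely many closed points with `f ≠ 0` — the special fibres there are ABELIAN
VARIETIES over `R ⧸ 𝔪` (Zariski's connectedness theorem, `ZariskiDVR.specialFibreAbelianVariety`) —
and conclude that the section is the unit section. [cite: MochizukiAbsTopIII2015, Rmk 1.5.4 (i) p.33] -/
theorem divisibleElementsTrivial_points_of_dedekind_of_residueFields (R : Type u) [CommRing R]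
    [IsDedekindDomain R] [Algebra ℚ R] (L : Type u) [Field L] [Algebra R L] [IsFractionRing R L]
    (hinf : {𝔪 : Ideal R | 𝔪.IsMaximal}.Infinite)
    (hres : ∀ (κ : Type u) [Field κ] (q : R →+* κ), Function.Surjective q → RingHom.ker q ≠ ⊥ →
      ∀ B : AbelianVariety κ, DivisibleElementsTrivial (B.Points κ))
    (A : AbelianVariety L) : DivisibleElementsTrivial (A.Points L) := by
  -- characteristic zero: `R`, `L` and all residue fields are perfect
  haveI : CharZero R := charZero_of_injective_algebraMap (algebraMap ℚ R).injective
  haveI : CharZero L := charZero_of_injective_algebraMap (IsFractionRing.injective R L)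
  haveI : PerfectField L := PerfectField.ofCharZero
  -- (2) spread `A` out to a proper smooth group scheme over some `R[1/f]`
  obtain ⟨f, hf0, hf⟩ := exists_abelianScheme_away_holds R L A.X
  have hfL : IsUnit (algebraMap R L f) := by
    rw [isUnit_iff_ne_zero, map_ne_zero_iff _ (IsFractionRing.injective R L)]
    exact hf0
  letI : Algebra (Localization.Away f) L := (IsLocalization.Away.lift f hfL).toAlgebra
  haveI : IsScalarTower R (Localization.Away f) L :=
    IsScalarTower.of_algebraMap_eq fun r => (IsLocalization.Away.lift_eq f hfL r).symm
  obtain ⟨𝒜, hprop, hsm, e, he⟩ := hf (Localization.Away f)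
  -- (3) `R[1/f]` is Dedekind with fraction field `L`; `𝒜` is the Néron model of `A`
  have hfpow : Submonoid.powers f ≤ nonZeroDivisors R := powers_le_nonZeroDivisors_of_noZeroDivisors hf0
  haveI : IsDomain (Localization.Away f) := IsLocalization.isDomain_localization hfpow
  haveI : IsDedekindDomain (Localization.Away f) :=
    IsLocalization.isDedekindDomain R hfpow (Localization.Away f)
  haveI : IsFractionRing (Localization.Away f) L :=
    IsFractionRing.isFractionRing_of_isDomain_of_isLocalization (Submonoid.powers f)
      (Localization.Away f) L
  haveI := hprop
  haveI := hsm
  haveI := he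
  have hN : IsNeronModel (Localization.Away f) L 𝒜.X A.X :=
    (isNeronModel_of_isProper_of_smooth (Localization.Away f) L 𝒜.X).of_iso_right e
  haveI : IsSeparated 𝒜.X.hom := hN.isSeparated
  -- the generic fibre of `𝒜` is geometrically irreducible (it is `A`)
  haveI : GeometricallyIrreducible (pullback.snd 𝒜.X.hom
      (Spec.map (CommRingCat.ofHom (algebraMap (Localization.Away f) L)))) :=
    ZariskiDVR.geometricallyIrreducible_genericFibre_of_iso (K := L) 𝒜.X A.X e
  -- (4) divisible points are divisible sections; it suffices to kill divisible sections
  refine IsNeronModel.divisibleElementsTrivial_points_of_sections A hN fun s hs => ?_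
  -- (5) the closed points `𝔪 ∌ f` of `Spec R`, their residue fields `R ⧸ 𝔪` and the field points
  --     `Spec (R ⧸ 𝔪) → Spec R[1/f]`
  have hunit : ∀ 𝔪 : {𝔪 : Ideal R // 𝔪.IsMaximal ∧ f ∉ 𝔪},
      IsUnit (Ideal.Quotient.mk 𝔪.1 f) := by
    intro 𝔪
    haveI : 𝔪.1.IsMaximal := 𝔪.2.1
    letI : Field (R ⧸ 𝔪.1) := Ideal.Quotient.field 𝔪.1
    rw [isUnit_iff_ne_zero, Ne, Ideal.Quotient.eq_zero_iff_mem]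
    exact 𝔪.2.2
  -- the point of `Spec R[1/f]` below `𝔪`: the kernel of `R[1/f] → R ⧸ 𝔪`
  let pt : {𝔪 : Ideal R // 𝔪.IsMaximal ∧ f ∉ 𝔪} → Spec (.of (Localization.Away f)) := fun 𝔪 =>
    ⟨RingHom.ker (IsLocalization.Away.lift f (hunit 𝔪)), by
      haveI : 𝔪.1.IsMaximal := 𝔪.2.1
      exact RingHom.ker_isPrime _⟩
  have hpt : ∀ 𝔪, (pt 𝔪).asIdeal.comap (algebraMap R (Localization.Away f)) = 𝔪.1 := by
    intro 𝔪
    change (RingHom.ker (IsLocalization.Away.lift f (hunit 𝔪))).comap _ = _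
    rw [RingHom.comap_ker, IsLocalization.Away.lift_comp, Ideal.mk_ker]
  have hpt_inj : Function.Injective pt := by
    intro 𝔪 𝔪' h
    apply Subtype.ext
    rw [← hpt 𝔪, ← hpt 𝔪', h]
  -- infinitely many such closed points
  have h3 : {𝔪 : Ideal R | 𝔪.IsMaximal ∧ f ∉ 𝔪}.Infinite := by
    have h2 : {𝔪 : Ideal R | 𝔪.IsMaximal ∧ f ∈ 𝔪}.Finite := by
      have hV := PrimeSpectrum.finite_zeroLocus_of_ne_bot (A := R) (I := Ideal.span {f})
        (by rwa [Ne, Ideal.span_singleton_eq_bot])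
      refine (hV.image PrimeSpectrum.asIdeal).subset fun 𝔪 h𝔪 => ?_
      refine ⟨⟨𝔪, h𝔪.1.isPrime⟩, ?_, rfl⟩
      rw [PrimeSpectrum.mem_zeroLocus, SetLike.coe_subset_coe, Ideal.span_singleton_le_iff_mem]
      exact h𝔪.2
    have hsub : {𝔪 : Ideal R | 𝔪.IsMaximal} ⊆
        {𝔪 : Ideal R | 𝔪.IsMaximal ∧ f ∈ 𝔪} ∪ {𝔪 : Ideal R | 𝔪.IsMaximal ∧ f ∉ 𝔪} := by
      intro 𝔪 h𝔪
      by_cases hfm : f ∈ 𝔪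
      · exact Or.inl ⟨h𝔪, hfm⟩
      · exact Or.inr ⟨h𝔪, hfm⟩
    intro hfin3
    exact hinf ((h2.union hfin3).subset hsub)
  haveI : Infinite {𝔪 : Ideal R // 𝔪.IsMaximal ∧ f ∉ 𝔪} := Set.infinite_coe_iff.mpr h3
  have hinf' : (Set.range pt).Infinite := Set.infinite_range_of_injective hpt_inj
  -- (6) the section `s` agrees with the unit section on each of these field points
  apply Over.OverMorphism.ext
  refine Spec.sections_ext_of_infinite_fieldPoints 𝒜.X.hom s.left (1 : 𝟙_ _ ⟶ 𝒜.X).left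
    (Over.w s) (Over.w _) (Set.range pt) hinf' ?_
  rintro _ ⟨𝔪, rfl⟩
  haveI : 𝔪.1.IsMaximal := 𝔪.2.1
  letI : Field (R ⧸ 𝔪.1) := Ideal.Quotient.field 𝔪.1
  -- the residue field `R ⧸ 𝔪` is perfect (characteristic zero)
  haveI : CharZero (R ⧸ 𝔪.1) :=
    charZero_of_injective_algebraMap (algebraMap ℚ (R ⧸ 𝔪.1)).injective
  haveI : PerfectField (R ⧸ 𝔪.1) := PerfectField.ofCharZero
  -- the field point `φ : Spec (R ⧸ 𝔪) → Spec R[1/f]` hits `pt 𝔪`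
  let q' : Localization.Away f →+* R ⧸ 𝔪.1 := IsLocalization.Away.lift f (hunit 𝔪)
  let φ : Spec (.of (R ⧸ 𝔪.1)) ⟶ Spec (.of (Localization.Away f)) :=
    Spec.map (CommRingCat.ofHom q')
  have hφpt : φ (IsLocalRing.closedPoint (R ⧸ 𝔪.1)) = pt 𝔪 := by
    apply PrimeSpectrum.ext
    change (PrimeSpectrum.comap _ (IsLocalRing.closedPoint (R ⧸ 𝔪.1))).asIdeal = _
    rw [PrimeSpectrum.comap_asIdeal]
    change (IsLocalRing.maximalIdeal (R ⧸ 𝔪.1)).comap (IsLocalization.Away.lift f (hunit 𝔪)) = _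
    rw [IsLocalRing.maximalIdeal_eq_bot, ← RingHom.ker_eq_comap_bot]
  refine ⟨R ⧸ 𝔪.1, inferInstance, φ, hφpt, ?_⟩
  -- `q' : R[1/f] ↠ R ⧸ 𝔪` is a closed point of `Spec R[1/f]`
  have h𝔪ne : 𝔪.1 ≠ ⊥ := ne_bot_of_isMaximal_of_infinite hinf 𝔪.2.1
  have hq' : Function.Surjective q' := fun y => by
    obtain ⟨r, rfl⟩ := Ideal.Quotient.mk_surjective y
    exact ⟨algebraMap R _ r, IsLocalization.Away.lift_eq f (hunit 𝔪) r⟩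
  have hker : RingHom.ker q' ≠ ⊥ := by
    intro h
    apply h𝔪ne
    rw [← hpt 𝔪]
    change (RingHom.ker q').comap _ = ⊥
    rw [h, Ideal.comap_bot_of_injective _ (IsLocalization.injective (Localization.Away f) hfpow)]
  -- (7) the special fibre at `𝔪` is an ABELIAN VARIETY over `R ⧸ 𝔪` (Zariski connectedness)
  let B : AbelianVariety (R ⧸ 𝔪.1) := ZariskiDVR.specialFibreAbelianVariety (K := L) q' hq' hker 𝒜.X
  -- the reduction of `s` at `𝔪` is a divisible point of `B`, hence trivial by hypothesis
  have hB : DivisibleElementsTrivial (B.Points (R ⧸ 𝔪.1)) :=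
    hres (R ⧸ 𝔪.1) (Ideal.Quotient.mk 𝔪.1) Ideal.Quotient.mk_surjective
      (by rw [Ideal.mk_ker]; exact h𝔪ne) B
  apply comp_left_eq_one_of_reduction_eq_one φ s
  exact hB.eq_one_of_forall_exists_pow _ (exists_pow_reduction_eq φ s hs)


/-- **The closed-point step in CURVE form: if every abelian variety over every FINITE extension of a
characteristic-zero field `F` satisfies Def. 1.5 (a), then so does every abelian variety over every
finite extension `L` of `F(X)`** — the Dedekind model `R :=` integral closure of `F[X]` in `L`
(`KummerFaithfulCurveDedekindProofs`: Dedekind, `Frac R = L`, infinitely many maximal ideals, residue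
fields finite over `F`) fed to `divisibleElementsTrivial_points_of_dedekind_of_residueFields`.  This is
exactly the printed reduction "by restricting to various closed points of this variety" one
transcendence degree at a time ([AbsTopIII] Rmk. 1.5.4 (i) p. 33); iterating it from the MLF case
(`isKummerFaithful_of_finite_padic`) along a transcendence basis gives Rmk. 1.5.4 (i) for finitely
generated extensions of `ℚ_p` (route «TRDEG-INDUCTION»). [cite: MochizukiAbsTopIII2015, Rmk 1.5.4 (i) p.33] -/
theorem divisibleElementsTrivial_points_of_finite_ratFunc_of_residueFields (F : Type u) [Field F]
    [CharZero F] (L : Type u) [Field L] [Algebra F[X] L] [Algebra (RatFunc F) L]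
    [IsScalarTower F[X] (RatFunc F) L] [FiniteDimensional (RatFunc F) L] [Algebra F L]
    [IsScalarTower F F[X] L]
    (hres : ∀ (κ : Type u) [Field κ] [Algebra F κ], Module.Finite F κ →
      ∀ B : AbelianVariety κ, DivisibleElementsTrivial (B.Points κ))
    (A : AbelianVariety L) : DivisibleElementsTrivial (A.Points L) := by
  haveI : Algebra.IsSeparable (RatFunc F) L := Algebra.IsAlgebraic.isSeparable_of_perfectField
  haveI : Infinite F := Infinite.of_injective ((↑) : ℕ → F) Nat.cast_injective
  haveI : IsDedekindDomain (integralClosure F[X] L) := isDedekindDomain_integralClosure_polynomial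
  haveI : IsFractionRing (integralClosure F[X] L) L := isFractionRing_integralClosure_polynomial
  letI : Algebra ℚ (integralClosure F[X] L) :=
    ((algebraMap F (integralClosure F[X] L)).comp (algebraMap ℚ F)).toAlgebra
  refine divisibleElementsTrivial_points_of_dedekind_of_residueFields (integralClosure F[X] L) L
    infinite_setOf_isMaximal_integralClosure_polynomial (fun κ _ q hq _ B => ?_) A
  -- the residue field `κ ≅ R ⧸ ker q` is finite over `F`
  haveI : (RingHom.ker q).IsMaximal := RingHom.ker_isMaximal_of_surjective q hq
  haveI : Module.Finite F (integralClosure F[X] L ⧸ RingHom.ker q) :=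
    finite_quotient_integralClosure_polynomial _
  letI : Algebra F κ := (q.comp (algebraMap F (integralClosure F[X] L))).toAlgebra
  let e : (integralClosure F[X] L ⧸ RingHom.ker q) ≃ₐ[F] κ :=
    AlgEquiv.ofRingEquiv (f := RingHom.quotientKerEquivOfSurjective hq) fun x => by
      change RingHom.kerLift q
          (Ideal.Quotient.mk _ (algebraMap F (integralClosure F[X] L) x)) =
        q (algebraMap F (integralClosure F[X] L) x)
      exact RingHom.kerLift_mk q _
  haveI hκ : Module.Finite F κ := Module.Finite.equiv e.toLinearEquiv
  exact hres κ hκ B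

end Literature.AnabelianGeometry.AbsoluteAnabelian.AbsTopIII
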